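import Summits.Parity.BatemanHorn.Theorems.SoloInformedHooleyShiftWeights

/-!
# Variation of clamped monotone sequences: `∑|∇² cl(t)| ≤ ∑|∇²t| + 4·sup ∇t`, sliding windows, `TV ≤ 1`

Informed soloist `solo-Parity-informed` (session 143), conjunct `BatemanHorn`, the `d ≥ 3` rung BELOW the parity
wall.  Generic real-sequence lemmas for the located weights `a_e(m) = cl(t_e(m))`, `cl(u) = max(0, min(1, u))`,
`t_e(m) = (Δ − log e + ½ log|g(m)|)/(2Δ)` nondecreasing in `m ≥ m₀` (`SoloInformedPolyDifferences`), as functions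
of `m` — the inputs of the second-order Abel summation in `m` (`SoloInformedAbelKernel`) of the trapezoid kernels:

* `sum_abs_clamp_second_diff_le`: for `t` nondecreasing, `∑_m |cl(t(m+2)) − 2cl(t(m+1)) + cl(t(m))| ≤
  ∑_m |t(m+2) − 2t(m+1) + t(m)| + 4·δ` whenever `t(m+2) − t(m) ≤ δ` throughout: the two kinks of the clamp cost
  only `sup ∇t`, because each level `0`, `1` is crossed by at most two of the windows `[t(m), t(m+2)]`
  (`card_filter_cross_le_two`);
* `sum_abs_succ_sub_clamp_window_le`: for `t` nondecreasing and `σ ≥ 0` the sliding-window overlap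
  `m ↦ cl(t(m)) − cl(t(m) − σ)` is unimodal, so its total variation is `≤ 3σ` (the `m`-analogue of
  `sum_abs_locWeight_sub_diff_le`, which did this in the modulus);
* `sum_abs_succ_sub_clamp_le_one`: `∑_m |cl(t(m+1)) − cl(t(m))| ≤ 1`.
-/

namespace Summit.Parity.BatemanHorn.Theorems

open Finset

/-! ### The clamp on its three pieces -/

/-- `cl(u) = u` on `[0, 1]`. [folklore] -/
theorem clamp_eq_self {u : ℝ} (h0 : 0 ≤ u) (h1 : u ≤ 1) : max 0 (min 1 u) = u := by
  rw [min_eq_right h1, max_eq_right h0]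

/-- `cl(u) = 0` for `u ≤ 0`. [folklore] -/
theorem clamp_eq_zero {u : ℝ} (h : u ≤ 0) : max 0 (min 1 u) = 0 :=
  max_eq_left ((min_le_right _ _).trans h)

/-- `cl(u) = 1` for `1 ≤ u`. [folklore] -/
theorem clamp_eq_one {u : ℝ} (h : 1 ≤ u) : max 0 (min 1 u) = 1 := by
  rw [min_eq_left h, max_eq_right zero_le_one]

/-- `0 ≤ cl(u) ≤ 1`. [folklore] -/
theorem clamp_nonneg (u : ℝ) : 0 ≤ max 0 (min 1 u) := le_max_left _ _

/-- `cl(u) ≤ 1`. [folklore] -/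
theorem clamp_le_one (u : ℝ) : max 0 (min 1 u) ≤ 1 := max_le zero_le_one (min_le_left _ _)

/-! ### Second differences of the clamp -/

/-- **No crossing ⇒ no kink**: if the window `[x, z]` (`x ≤ y ≤ z`) lies inside one of the three pieces
`(−∞, 0)`, `[0, 1]`, `(1, ∞)` of the clamp, then `|cl z − 2cl y + cl x| ≤ |z − 2y + x|`. [folklore] -/
theorem abs_clamp_second_diff_le_of_no_cross {x y z : ℝ} (hxy : x ≤ y) (hyz : y ≤ z)
    (h : (0 ≤ x ∧ z ≤ 1) ∨ z < 0 ∨ 1 < x) :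
    |max 0 (min 1 z) - 2 * max 0 (min 1 y) + max 0 (min 1 x)| ≤ |z - 2 * y + x| := by
  rcases h with ⟨h0, h1⟩ | hz | hx
  · rw [clamp_eq_self h0 (hxy.trans (hyz.trans h1)), clamp_eq_self (h0.trans hxy) (hyz.trans h1),
      clamp_eq_self (h0.trans (hxy.trans hyz)) h1]
  · rw [clamp_eq_zero hz.le, clamp_eq_zero (hyz.trans hz.le), clamp_eq_zero (hxy.trans (hyz.trans hz.le))]
    norm_num
  · rw [clamp_eq_one hx.le, clamp_eq_one (hx.le.trans hxy), clamp_eq_one (hx.le.trans (hxy.trans hyz))]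
    norm_num

/-- **A kink costs at most the window**: `|cl z − 2cl y + cl x| ≤ z − x` for `x ≤ y ≤ z` (the clamp is
`1`-Lipschitz). [folklore] -/
theorem abs_clamp_second_diff_le {x y z : ℝ} (hxy : x ≤ y) (hyz : y ≤ z) :
    |max 0 (min 1 z) - 2 * max 0 (min 1 y) + max 0 (min 1 x)| ≤ z - x := by
  have h1 := Literature.NumberTheory.LFunctions.PlateauMollifier.abs_clamp_sub_clamp_le z y
  have h2 := Literature.NumberTheory.LFunctions.PlateauMollifier.abs_clamp_sub_clamp_le y x
  rw [abs_of_nonneg (by linarith : 0 ≤ z - y)] at h1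
  rw [abs_of_nonneg (by linarith : 0 ≤ y - x)] at h2
  calc |max 0 (min 1 z) - 2 * max 0 (min 1 y) + max 0 (min 1 x)|
      = |(max 0 (min 1 z) - max 0 (min 1 y)) - (max 0 (min 1 y) - max 0 (min 1 x))| := by ring_nf
    _ ≤ |max 0 (min 1 z) - max 0 (min 1 y)| + |max 0 (min 1 y) - max 0 (min 1 x)| := abs_sub _ _
    _ ≤ (z - y) + (y - x) := add_le_add h1 h2
    _ = z - x := by ring

/-- **Each level is crossed by at most two windows**: for `t` nondecreasing on `[A, B+2]` and a downward-closed
property `P` (e.g. `u < 0` or `u ≤ 1`), at most two `m ∈ [A, B]` have `P(t(m))` and `¬P(t(m+2))`. [folklore] -/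
theorem card_filter_cross_le_two (t : ℕ → ℝ) (P : ℝ → Prop) [DecidablePred P]
    (hP : ∀ u v : ℝ, u ≤ v → P v → P u) {A B : ℕ}
    (hmono : ∀ i j : ℕ, A ≤ i → i ≤ j → j ≤ B + 2 → t i ≤ t j) :
    #((Icc A B).filter fun m => P (t m) ∧ ¬P (t (m + 2))) ≤ 2 := by
  set s := (Icc A B).filter fun m => P (t m) ∧ ¬P (t (m + 2)) with hs
  rcases s.eq_empty_or_nonempty with h0 | hne
  · rw [h0]; simp
  set m₀ := s.min' hne with hm₀
  have hm₀s : m₀ ∈ s := min'_mem s hne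
  have hsub : s ⊆ Icc m₀ (m₀ + 1) := by
    intro m hm
    have h1 : m₀ ≤ m := min'_le s m hm
    rw [mem_Icc]
    refine ⟨h1, ?_⟩
    by_contra h2
    push Not at h2
    rw [hs, mem_filter, mem_Icc] at hm hm₀s
    -- `t(m₀+2) ≤ t(m)` and `P(t m)` give `P(t(m₀+2))`
    have h3 : t (m₀ + 2) ≤ t m := hmono _ _ (by omega) (by omega) (by omega)
    exact hm₀s.2.2 (hP _ _ h3 hm.2.1)
  calc #s ≤ #(Icc m₀ (m₀ + 1)) := card_le_card hsub
    _ = 2 := by rw [Nat.card_Icc]; omega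

/-- **SECOND VARIATION OF A CLAMPED MONOTONE SEQUENCE.**  For `t` nondecreasing on `[A, B+2]` with
`t(m+2) − t(m) ≤ δ` (`A ≤ m ≤ B`):
`∑_{A≤m≤B} |cl(t(m+2)) − 2cl(t(m+1)) + cl(t(m))| ≤ ∑_{A≤m≤B} |t(m+2) − 2t(m+1) + t(m)| + 4δ`. [this work] -/
theorem sum_abs_clamp_second_diff_le (t : ℕ → ℝ) {A B : ℕ} {δ : ℝ} (hδ : 0 ≤ δ)
    (hmono : ∀ i j : ℕ, A ≤ i → i ≤ j → j ≤ B + 2 → t i ≤ t j)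
    (hstep : ∀ m ∈ Icc A B, t (m + 2) - t m ≤ δ) :
    ∑ m ∈ Icc A B, |max 0 (min 1 (t (m + 2))) - 2 * max 0 (min 1 (t (m + 1))) + max 0 (min 1 (t m))|
      ≤ ∑ m ∈ Icc A B, |t (m + 2) - 2 * t (m + 1) + t m| + 4 * δ := by
  -- pointwise: `|∇²cl(t)| ≤ |∇²t| + δ·𝟙[0-crossing] + δ·𝟙[1-crossing]`
  have hpt : ∀ m ∈ Icc A B,
      |max 0 (min 1 (t (m + 2))) - 2 * max 0 (min 1 (t (m + 1))) + max 0 (min 1 (t m))|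
        ≤ |t (m + 2) - 2 * t (m + 1) + t m|
          + (if t m < 0 ∧ ¬(t (m + 2) < 0) then δ else 0)
          + (if t m ≤ 1 ∧ ¬(t (m + 2) ≤ 1) then δ else 0) := by
    intro m hm
    have hmI := mem_Icc.mp hm
    have hxy : t m ≤ t (m + 1) := hmono _ _ hmI.1 (by omega) (by omega)
    have hyz : t (m + 1) ≤ t (m + 2) := hmono _ _ (by omega) (by omega) (by omega)
    have habs : 0 ≤ |t (m + 2) - 2 * t (m + 1) + t m| := abs_nonneg _
    by_cases hc : (t m < 0 ∧ ¬(t (m + 2) < 0)) ∨ (t m ≤ 1 ∧ ¬(t (m + 2) ≤ 1))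
    · -- a crossing: the kink costs `≤ t(m+2) − t(m) ≤ δ`
      have h1 := abs_clamp_second_diff_le hxy hyz
      have h2 := hstep m hm
      rcases hc with hc0 | hc1
      · rw [if_pos hc0]
        have : 0 ≤ (if t m ≤ 1 ∧ ¬(t (m + 2) ≤ 1) then δ else 0) := by split_ifs <;> linarith
        linarith
      · rw [if_pos hc1]
        have : 0 ≤ (if t m < 0 ∧ ¬(t (m + 2) < 0) then δ else 0) := by split_ifs <;> linarith
        linarith
    · -- no crossing
      push Not at hc
      have hcase : (0 ≤ t m ∧ t (m + 2) ≤ 1) ∨ t (m + 2) < 0 ∨ 1 < t m := by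
        rcases lt_or_ge (t (m + 2)) 0 with h | h
        · exact Or.inr (Or.inl h)
        · rcases lt_or_ge 1 (t m) with h' | h'
          · exact Or.inr (Or.inr h')
          · refine Or.inl ⟨?_, hc.2 h'⟩
            by_contra hneg
            push Not at hneg
            exact absurd (hc.1 hneg) (not_lt.mpr h)
      have h1 := abs_clamp_second_diff_le_of_no_cross hxy hyz hcase
      have h3 : 0 ≤ (if t m < 0 ∧ ¬(t (m + 2) < 0) then δ else 0) := by split_ifs <;> linarith
      have h4 : 0 ≤ (if t m ≤ 1 ∧ ¬(t (m + 2) ≤ 1) then δ else 0) := by split_ifs <;> linarith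
      linarith
  refine (sum_le_sum hpt).trans ?_
  rw [sum_add_distrib, sum_add_distrib, ← sum_filter, ← sum_filter, sum_const, sum_const, nsmul_eq_mul,
    nsmul_eq_mul]
  have hc0 := card_filter_cross_le_two t (fun u => u < 0) (fun u v huv hv => lt_of_le_of_lt huv hv) hmono
  have hc1 := card_filter_cross_le_two t (fun u => u ≤ 1) (fun u v huv hv => huv.trans hv) hmono
  have h0 : (#((Icc A B).filter fun m => t m < 0 ∧ ¬(t (m + 2) < 0)) : ℝ) ≤ 2 := by exact_mod_cast hc0
  have h1 : (#((Icc A B).filter fun m => t m ≤ 1 ∧ ¬(t (m + 2) ≤ 1)) : ℝ) ≤ 2 := by exact_mod_cast hc1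
  nlinarith

/-! ### Sliding windows and total variation -/

/-- **UNIMODALITY OF THE SLIDING WINDOW IN `m`.**  For `t` nondecreasing on `[A, B]` and `σ ≥ 0`, the overlap
`f(m) = cl(t(m)) − cl(t(m) − σ)` rises while `t ≤ σ` and falls afterwards, so `∑_{A≤m<B} |f(m+1) − f(m)| ≤ 3σ`.
[this work] -/
theorem sum_abs_succ_sub_clamp_window_le (t : ℕ → ℝ) {σ : ℝ} (hσ : 0 ≤ σ) {A B : ℕ}
    (hmono : ∀ i j : ℕ, A ≤ i → i ≤ j → j ≤ B → t i ≤ t j) :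
    ∑ m ∈ Ico A B, |(max 0 (min 1 (t (m + 1))) - max 0 (min 1 (t (m + 1) - σ)))
        - (max 0 (min 1 (t m)) - max 0 (min 1 (t m - σ)))| ≤ 3 * σ := by
  set f : ℕ → ℝ := fun m => max 0 (min 1 (t m - σ + σ)) - max 0 (min 1 (t m - σ)) with hf
  have hfeq : ∀ m, max 0 (min 1 (t m)) - max 0 (min 1 (t m - σ)) = f m := fun m => by
    simp only [hf, sub_add_cancel]
  simp_rw [hfeq]
  set p : ℕ := Nat.findGreatest (fun m => t m ≤ σ) B with hp
  obtain ⟨hpB, hpP, hpmax⟩ := (Nat.findGreatest_eq_iff.mp hp.symm)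
  have hbound : ∀ m, A ≤ m → m ≤ B → 0 ≤ f m ∧ f m ≤ σ := by
    intro m _ _
    refine ⟨sub_nonneg.mpr (clamp_mono (by linarith)), ?_⟩
    have h := Literature.NumberTheory.LFunctions.PlateauMollifier.abs_clamp_sub_clamp_le (t m - σ + σ) (t m - σ)
    rw [show t m - σ + σ - (t m - σ) = σ by ring, abs_of_nonneg hσ] at h
    exact (le_abs_self _).trans h
  have hinc : ∀ e₁ e₂, A ≤ e₁ → e₁ ≤ e₂ → e₂ ≤ p → e₂ ≤ B → f e₁ ≤ f e₂ := by
    intro e₁ e₂ h₁ h₁₂ h₂ h₂B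
    rcases eq_or_lt_of_le h₁₂ with heq | hlt
    · rw [heq]
    · have hp0 : p ≠ 0 := by omega
      have htp : t p ≤ σ := hpP hp0
      have ht₂ : t e₂ - σ ≤ 0 := by linarith [hmono e₂ p (by omega) h₂ hpB]
      exact clamp_window_monotone (by linarith [hmono e₁ e₂ h₁ h₁₂ h₂B]) ht₂
  have hdec : ∀ e₁ e₂, p < e₁ → e₁ ≤ e₂ → A ≤ e₁ → e₂ ≤ B → f e₂ ≤ f e₁ := by
    intro e₁ e₂ h₁ h₁₂ hA₁ h₂B
    have ht₁ : ¬(t e₁ ≤ σ) := hpmax h₁ (by omega)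
    push Not at ht₁
    exact clamp_window_antitone hσ (by linarith) (by linarith [hmono e₁ e₂ hA₁ h₁₂ h₂B])
  exact sum_abs_succ_sub_le_of_unimodal f hσ hbound hinc hdec

/-- **Total variation of a clamped monotone sequence is `≤ 1`**: for `t` nondecreasing on `[A, B]`,
`∑_{A≤m<B} |cl(t(m+1)) − cl(t(m))| ≤ 1`. [folklore] -/
theorem sum_abs_succ_sub_clamp_le_one (t : ℕ → ℝ) {A B : ℕ}
    (hmono : ∀ i j : ℕ, A ≤ i → i ≤ j → j ≤ B → t i ≤ t j) :
    ∑ m ∈ Ico A B, |max 0 (min 1 (t (m + 1))) - max 0 (min 1 (t m))| ≤ 1 := by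
  rcases lt_or_ge B A with hBA | hAB
  · rw [Ico_eq_empty (by omega), sum_empty]; exact zero_le_one
  have heq : ∀ m ∈ Ico A B, |max 0 (min 1 (t (m + 1))) - max 0 (min 1 (t m))|
      = max 0 (min 1 (t (m + 1))) - max 0 (min 1 (t m)) := by
    intro m hm
    rw [mem_Ico] at hm
    exact abs_of_nonneg (sub_nonneg.mpr (clamp_mono (hmono _ _ hm.1 (by omega) (by omega))))
  rw [sum_congr rfl heq, sum_Ico_succ_sub (fun m => max 0 (min 1 (t m))) hAB]
  linarith [clamp_le_one (t B), clamp_nonneg (t A)]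

end Summit.Parity.BatemanHorn.Theorems
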